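import Literature.NumberTheory.EllipticCurves.WeilPairingLevelCompatProofs
import Literature.NumberTheory.EllipticCurves.HeegnerPointsKolyvaginConjugation
import Literature.NumberTheory.EllipticCurves.ConjugatePairingDuality
import Literature.NumberTheory.EllipticCurves.HeegnerModuleIndex
import Literature.NumberTheory.GaloisRepresentations.CompatibleRootsOfUnityLogProofs
import Literature.NumberTheory.GaloisRepresentations.ContinuousRepHomDual
import HarnessLib

/-!
# The `E`-level datum of Howard's H.4 for `E/ℚ` over a number field `K`, LEVEL-COMPATIBLY:
# the Weil pairings `e_j : E_K[p^j] × E_K[p^j] → μ_{p^j}(K̄)`, a compatible discrete logarithm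
# `log_j : μ_{p^j}(K̄) ≅ ℤ/p^j`, and the forms `ẽ_j(a, b) = log_j e_j(a, τ_* b)` (proofs file)

Topic `NumberTheory/EllipticCurves`. THEOREMS ONLY; no definition, no named fact, no instance, no `sorry`.

Howard, Compositio **140** (2004), §1.3 hypothesis H.4 asks for a perfect, symmetric, `R(1)`-valued pairing on
`T` with `(s^σ, t^{τστ⁻¹}) = (s, t)^σ`; Remark 1.3.2: «If `R = ℤ_p`, `T` is the `p`-adic Tate module of an elliptic
curve over `ℚ`, and `e : T × T → ℤ_p(1)` is the Weil pairing, then the pairing `(s, t) = e(s, t^τ)` has the desired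
properties».  For the cell's specialised DVR setting (`WeierstrassCurve.eisensteinDVRSetting`, levels
`E_K[p^{k+1}] ⊗ A_{m,k+1}(ψ)`, duality data `D k := ZpExtension.eisensteinDualityDatum … ẽ …` from an `E`-level form
`ẽ : E_K[p^j] × E_K[p^j] → ℤ/p^j`, tree `ConjugatePairingDuality.conjPairing e θ log`) the `E`-level inputs must be
supplied at EVERY level `j` and COMPATIBLY in `j` (field `SatisfiesH.e_red`: the level-`k` pairing is the reduction
of the level-`k+1` one).  This file supplies them, for `E = W/ℚ` elliptic, `K` a number field, `p` a prime and a
lift `τ` of an automorphism of `K` which is (the transport to `K̄` of) a complex conjugation `c₀ ∈ Γ_ℚ` — the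
hypothesis shape of the tree's `h5a_residualTauGeomTorsion_of_isComplexConjugation`:

* `WeierstrassCurve.exists_weilPairingHom_tower_baseChange` — ONE family of bi-additive pairings
  `e_j : E_K[p^j] →+ E_K[p^j] →+ μ_{p^j}(K̄)` (`geomTorsion (W.baseChange K) ((p : ℤ) ^ j)`,
  `DiscreteGaloisModule.MuCarrier K (p ^ j)`) and additive `log_j : μ_{p^j}(K̄) →+ ℤ/p^j` with: `e_j` alternating,
  skew, `Γ_K`-equivariant, **`e_j(τ_* a, τ_* b) = −e_j(a, b)`** (`c₀` inverts roots of unity), left-non-degenerate,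
  exhausting `Hom(E_K[p^j], μ_{p^j})`, and **compatible**: `e_j(p·a, p·b) = (e_{j+1}(a, b))^p` along
  `geomTorsionReduce` (as units of `K̄`); `log_j` bijective, `log_j(g·ξ) = χ̄_j(g) log_j ξ`
  (`cyclotomicCharacterModPow`), and compatible: `log_j(ξ^p) = log_{j+1}(ξ) mod p^j` — the `log` family IS the
  tree's `exists_compatible_muLog` (x9-p1-w4, `CompatibleRootsOfUnityLogProofs`), re-exported in the same tuple.
  Construction: the tree's compatible Weil tower `exists_weilPairing_tower` of `W` over `ℚ̄` (Silverman III.8.1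
  (a)–(e)) transported along `RatClosure.torsionEquiv : E(ℚ̄)[n] ≃ E(K̄)[n]` and `absClosureEmbedding ℚ K`; the
  sign from `RatClosure.smul_eq_inv_of_pow_eq_one` (`c₀ ζ = ζ⁻¹`).
* `WeierstrassCurve.exists_conjPairing_tower` — the consumer form: for `ẽ_j := conjPairing (e j) τ_* (log j)` the
  four hypotheses of `ZpExtension.eisensteinDualityDatum` (symmetric, `(g, τ⁻¹gτ)`-equivariant with the mod-`p^j`
  cyclotomic factor, left-non-degenerate, exhausting) at every level, **the level compatibility
  `ẽ_j(p·a, p·b) = ZMod.castHom (ẽ_{j+1}(a, b))`**, and the sign identity `ẽ_j(τ_* a, τ_* b) = −ẽ_j(a, b)` (H.5(c)),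
  together with the raw facts `e_j(a, a) = 0`, `τ_*` involutive and commuting with `p·` (used by the H.4 local clause).
* Private helpers: `exists_biadditive_muCarrier` (a multiplicative `μ_n`-valued function IS a bi-additive map into
  `MuCarrier`), `torsionMap_geomTorsionReduce` (`τ_*` commutes with `p·`).

Cell `pub/bsd-print-x9`, seat `bsd-line-x9-p1-w2` (g7); the «level-COMPATIBLE Weil-pairing family for the `D`
parameter» of x10b-p1 LEAD g7's STUB-1 board (shared μ-crux stmt-BirchSwinnertonDyer-22642). BSD is not proved by any
of this.

References: [Howard2004HeegnerKolyvagin] B. Howard, *The Heegner point Kolyvagin system*, Compositio Math. 140 (2004),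
§1.3 (H.4) and Rem. 1.3.2 (arXiv:1202.6340 p. 7, L69–90); [SilvermanAEC2009] J. H. Silverman, *The Arithmetic of
Elliptic Curves*, 2nd ed., Prop. III.8.1 (a)–(e); [McCallumLMS1991] W. McCallum, *Kolyvagin's work on Shafarevich–Tate
groups*, §3 («`τ` acts as `−1` on `p^∞`-th roots of unity»).
-/

noncomputable section

open scoped Classical

namespace WeierstrassCurve

open Literature.NumberTheory.EllipticCurves Literature.NumberTheory.GaloisRepresentations Field
open Literature.NumberTheory.GaloisRepresentations.DiscreteGaloisModule

variable (W : WeierstrassCurve ℚ) [W.IsElliptic] {K : Type} [Field K] [NumberField K] (p : ℕ) [hp : Fact p.Prime]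

/-! ## §1 Bi-additive packaging of a multiplicative `μ_n`-valued function -/

omit [NumberField K] hp in
/-- A function `f : A × B → K̄` with values `n`-th roots of unity and multiplicative in each variable IS a
bi-additive map `A →+ B →+ μ_n(K̄)` (as the tree's `weilPairingHom`, for arbitrary index groups). [folklore] -/
private theorem exists_biadditive_muCarrier {A B : Type*} [AddCommGroup A] [AddCommGroup B] (n : ℕ) [NeZero n]
    (f : A → B → AlgebraicClosure K) (hpow : ∀ a b, f a b ^ n = 1)
    (haddl : ∀ a₁ a₂ b, f (a₁ + a₂) b = f a₁ b * f a₂ b) (haddr : ∀ a b₁ b₂, f a (b₁ + b₂) = f a b₁ * f a b₂) :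
    ∃ e : A →+ B →+ MuCarrier K n,
      ∀ a b, ((muVal K n (e a b) : (AlgebraicClosure K)ˣ) : AlgebraicClosure K) = f a b := by
  refine ⟨AddMonoidHom.mk' (fun a ↦ AddMonoidHom.mk'
      (fun b ↦ MuCarrier.ofRootsOfUnity (rootsOfUnity.mkOfPowEq (f a b) (hpow a b))) ?_) ?_, fun a b ↦ ?_⟩
  · intro b₁ b₂
    apply muVal_injective K n
    apply Units.ext
    simp only [muVal_add, muVal_ofRootsOfUnity, Units.val_mul, rootsOfUnity.val_mkOfPowEq_coe, haddr]
  · intro a₁ a₂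
    ext b
    apply muVal_injective K n
    apply Units.ext
    simp only [AddMonoidHom.mk'_apply, AddMonoidHom.add_apply, muVal_add, muVal_ofRootsOfUnity, Units.val_mul,
      rootsOfUnity.val_mkOfPowEq_coe, haddl]
  · simp only [AddMonoidHom.mk'_apply, muVal_ofRootsOfUnity, rootsOfUnity.val_mkOfPowEq_coe]

/-! ## §2 The Weil tower of `E/ℚ` on `E_K[p^j]`, with the complex conjugation -/

/-- **The level-compatible Weil pairings on `E_K[p^j]` with a complex conjugation, and a compatible discrete
logarithm.**  For `E = W/ℚ` elliptic, `K` a number field, `p` prime, `τ` a lift to `K̄` of `σ ∈ Aut(K/ℚ)` which is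
the transport of a complex conjugation `c₀ ∈ Γ_ℚ`: there are bi-additive `e_j : E_K[p^j] × E_K[p^j] → μ_{p^j}(K̄)`
and additive `log_j : μ_{p^j}(K̄) → ℤ/p^j` (`j ≥ 0`) with — in this order — `e_j(a, a) = 0`; `e_j(b, a) = −e_j(a, b)`;
`e_j(ga, gb) = g · e_j(a, b)` (`g ∈ Γ_K`); `e_j(τ_* a, τ_* b) = −e_j(a, b)`; `e_j(a, ·) = 0 ⇒ a = 0`; every
`ψ : E_K[p^j] →+ μ_{p^j}` is `e_j(w, ·)`; `e_j(p·a, p·b) = e_{j+1}(a, b)^p` (`geomTorsionReduce`, as units of `K̄`);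
`log_j` bijective; `log_j(g · ξ) = χ̄_j(g) log_j ξ`; `log_j(ξ') = log_{j+1} ξ mod p^j` when `ξ' = ξ^p` (the tree's
`exists_compatible_muLog`).  (Silverman III.8.1 (a)–(e) for `W` over `ℚ̄` = tree `exists_weilPairing_tower`,
transported by `RatClosure.torsionEquiv`; `c₀ ζ = ζ⁻¹`.)
[cite: SilvermanAEC2009, Prop. III.8.1 (a)–(e)] [cite: Howard2004HeegnerKolyvagin, Rem. 1.3.2 (arXiv p. 7, L81–88)] -/
theorem exists_weilPairingHom_tower_baseChange {σ : K ≃ₐ[ℚ] K} {τ : AlgebraicClosure K ≃+* AlgebraicClosure K}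
    (hτ : IsLiftOfAut σ τ) {c₀ : absoluteGaloisGroup ℚ} (hc₀ : IsComplexConjugation (Rat.castHom ℝ) c₀)
    (hγ : ∀ x, τ x = absGaloisTransport (K := ℚ) (L := K) c₀ x) :
    ∃ (e : ∀ j : ℕ, geomTorsion (W.baseChange K) ((p : ℤ) ^ j) →+ geomTorsion (W.baseChange K) ((p : ℤ) ^ j) →+
        MuCarrier K (p ^ j))
      (log : ∀ j : ℕ, MuCarrier K (p ^ j) →+ ZMod (p ^ j)),
      (∀ j a, e j a a = 0) ∧
      (∀ j a b, e j b a = -e j a b) ∧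
      (∀ j (g : absoluteGaloisGroup K) a b, e j (g • a) (g • b) = mu K (p ^ j) g (e j a b)) ∧
      (∀ j a b, e j (hτ.torsionMap W _ a) (hτ.torsionMap W _ b) = -e j a b) ∧
      (∀ j a, (∀ b, e j a b = 0) → a = 0) ∧
      (∀ j (ψ : geomTorsion (W.baseChange K) ((p : ℤ) ^ j) →+ MuCarrier K (p ^ j)), ∃ w, ∀ b, e j w b = ψ b) ∧
      (∀ j a b, muVal K (p ^ j)
          (e j ((W.baseChange K).geomTorsionReduce p j a) ((W.baseChange K).geomTorsionReduce p j b)) =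
        muVal K (p ^ (j + 1)) (e (j + 1) a b) ^ p) ∧
      (∀ j, Function.Bijective (log j)) ∧
      (∀ j (g : absoluteGaloisGroup K) ξ, log j (mu K (p ^ j) g ξ) = cyclotomicCharacterModPow K p j g * log j ξ) ∧
      (∀ j (v : MuCarrier K (p ^ (j + 1))) (w : MuCarrier K (p ^ j)),
        muVal K (p ^ j) w = muVal K (p ^ (j + 1)) v ^ p →
          log j w = ZMod.castHom (pow_dvd_pow p j.le_succ) (ZMod (p ^ j)) (log (j + 1) v)) := by
  have hpp := hp.out
  haveI : NeZero p := ⟨hpp.ne_zero⟩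
  haveI : NeZero (p : K) := ⟨by exact_mod_cast hpp.ne_zero⟩
  have hp0 : (p : ℚ) ≠ 0 := by exact_mod_cast hpp.ne_zero
  -- notation
  set E := W.baseChange K with hE
  let M : ℕ → Type := fun j ↦ geomTorsion E ((p : ℤ) ^ j)
  let ι : ∀ j, geomTorsion E ((p : ℤ) ^ j) ≃+ geomTorsion W ((p : ℤ) ^ j) := fun j ↦
    (RatClosure.torsionEquiv (K := K) W ((p : ℤ) ^ j)).symm
  let A : ∀ j, geomTorsion E ((p : ℤ) ^ j) → geomPoints W := fun j a ↦ (ι j a : geomPoints W)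
  let ιK : AlgebraicClosure ℚ →ₐ[ℚ] AlgebraicClosure K := absClosureEmbedding ℚ K
  have hcast : ∀ j : ℕ, ((p ^ j : ℕ) : ℤ) = (p : ℤ) ^ j := fun j ↦ by push_cast; rfl
  have hA : ∀ j (a : geomTorsion E ((p : ℤ) ^ j)), ((p ^ j : ℕ) : ℤ) • A j a = 0 := fun j a ↦ by
    rw [hcast]
    exact (mem_geomTorsion_iff W _ _).mp (ι j a).2
  have hAadd : ∀ j (a b : geomTorsion E ((p : ℤ) ^ j)), A j (a + b) = A j a + A j b := fun j a b ↦ by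
    simp only [A, map_add, AddSubgroup.coe_add]
  -- every `p^j`-torsion point of `E(ℚ̄)` is some `A j b`
  have hAsurj : ∀ j (S : geomPoints W), ((p ^ j : ℕ) : ℤ) • S = 0 → ∃ b, A j b = S := fun j S hS ↦ by
    rw [hcast] at hS
    exact ⟨(ι j).symm ⟨S, (mem_geomTorsion_iff W _ _).mpr hS⟩, by simp only [A, AddEquiv.apply_symm_apply]⟩
  -- the Weil tower of `W` over `ℚ̄`
  obtain ⟨w, hw_pow, hw_addl, hw_addr, hw_self, hw_nd, hw_gal, hw_compat⟩ :=
    exists_weilPairing_tower (W := W) (p := p) hp0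
  -- the transported values and their packaging
  let f : ∀ j, geomTorsion E ((p : ℤ) ^ j) → geomTorsion E ((p : ℤ) ^ j) → AlgebraicClosure K :=
    fun j a b ↦ ιK (w j (A j a) (A j b))
  have hf : ∀ j, ∃ e : geomTorsion E ((p : ℤ) ^ j) →+ geomTorsion E ((p : ℤ) ^ j) →+ MuCarrier K (p ^ j),
      ∀ a b, ((muVal K (p ^ j) (e a b) : (AlgebraicClosure K)ˣ) : AlgebraicClosure K) = f j a b := fun j ↦ by
    refine exists_biadditive_muCarrier (K := K) (p ^ j) (f j) (fun a b ↦ ?_) (fun a₁ a₂ b ↦ ?_) (fun a b₁ b₂ ↦ ?_)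
    · simp only [f, ← map_pow, hw_pow j _ _ (hA j a) (hA j b), map_one]
    · simp only [f, hAadd, hw_addl _ _ _ _ (hA j a₁) (hA j a₂) (hA j b), map_mul]
    · simp only [f, hAadd, hw_addr _ _ _ _ (hA j a) (hA j b₁) (hA j b₂), map_mul]
  choose e he using hf
  have hext : ∀ j (x y : MuCarrier K (p ^ j)),
      ((muVal K (p ^ j) x : (AlgebraicClosure K)ˣ) : AlgebraicClosure K) = (muVal K (p ^ j) y : AlgebraicClosure K) →
        x = y := fun j x y h ↦ muVal_injective K _ (Units.ext h)
  have hneg : ∀ j (x : MuCarrier K (p ^ j)),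
      ((muVal K (p ^ j) (-x) : (AlgebraicClosure K)ˣ) : AlgebraicClosure K) =
        ((muVal K (p ^ j) x : (AlgebraicClosure K)ˣ) : AlgebraicClosure K)⁻¹ := fun j x ↦ by
    rw [← Units.val_inv_eq_inv_val]
    exact congrArg Units.val (by rw [eq_inv_iff_mul_eq_one, ← muVal_add, neg_add_cancel, muVal_zero])
  -- the compatible discrete logarithm (x9-p1-w4's `exists_compatible_muLog`)
  obtain ⟨log, hlog_bij, hlog_cyc, hlog_compat⟩ := exists_compatible_muLog K p (NeZero.ne (p : K))
  -- (W1) alternating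
  have hιK1 : ∀ j, ((muVal K (p ^ j) 0 : (AlgebraicClosure K)ˣ) : AlgebraicClosure K) = ιK 1 := fun j ↦ by
    rw [muVal_zero, Units.val_one, map_one]
  have hW1 : ∀ j a, e j a a = 0 := fun j a ↦ hext j _ _ (by
    rw [he, hιK1]
    exact congrArg ιK (hw_self j _ (hA j a)))
  -- (W2) skew
  have hW2 : ∀ j a b, e j b a = -e j a b := fun j a b ↦ by
    have h := hW1 j (a + b)
    simp only [map_add, AddMonoidHom.add_apply, hW1, zero_add, add_zero] at h
    exact eq_neg_of_add_eq_zero_left h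
  -- (W3) `Γ_K`-equivariance
  have hιg : ∀ j (g : absoluteGaloisGroup K) (a : geomTorsion E ((p : ℤ) ^ j)),
      ι j (g • a) = absGaloisRestrict ℚ K g • ι j a := fun j g a ↦ by
    apply (AddEquiv.symm_apply_eq _).mpr
    change g • a = RatClosure.torsionEquiv W _ (absGaloisRestrict ℚ K g • ι j a)
    rw [RatClosure.torsionEquiv_smul]
    exact (congrArg (g • ·) ((RatClosure.torsionEquiv W _).apply_symm_apply a)).symm
  have hAg : ∀ j (g : absoluteGaloisGroup K) (a : geomTorsion E ((p : ℤ) ^ j)),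
      A j (g • a) = absGaloisRestrict ℚ K g • A j a := fun j g a ↦ by
    simp only [A, hιg, Literature.NumberTheory.EllipticCurves.AddSubgroup.torsionBy.coe_smul]
  have hιKg : ∀ (g : absoluteGaloisGroup K) (x : AlgebraicClosure ℚ), ιK (absGaloisRestrict ℚ K g • x) = g • ιK x :=
    fun g x ↦ absGaloisRestrict_apply_smul ℚ K g x
  have hW3 : ∀ j (g : absoluteGaloisGroup K) a b, e j (g • a) (g • b) = mu K (p ^ j) g (e j a b) :=
    fun j g a b ↦ hext j _ _ (by
      rw [he, muVal_apply, Units.coe_smul, he]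
      change ιK (w j (A j (g • a)) (A j (g • b))) = g • ιK (w j (A j a) (A j b))
      rw [hAg, hAg, hw_gal j _ _ _ (hA j a) (hA j b), hιKg])
  -- (W4) `τ` is anti-equivariant: `c₀` inverts roots of unity
  have hιτ : ∀ j (a : geomTorsion E ((p : ℤ) ^ j)), ι j (hτ.torsionMap W _ a) = c₀ • ι j a := fun j a ↦ by
    apply (AddEquiv.symm_apply_eq _).mpr
    change hτ.torsionMap W _ a = RatClosure.torsionEquiv W _ (c₀ • ι j a)
    rw [RatClosure.torsionEquiv_smul_of_lift W hτ c₀ hγ]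
    exact (congrArg (hτ.torsionMap W _) ((RatClosure.torsionEquiv W _).apply_symm_apply a)).symm
  have hAτ : ∀ j (a : geomTorsion E ((p : ℤ) ^ j)), A j (hτ.torsionMap W _ a) = c₀ • A j a := fun j a ↦ by
    simp only [A, hιτ, Literature.NumberTheory.EllipticCurves.AddSubgroup.torsionBy.coe_smul]
  have hW4 : ∀ j a b, e j (hτ.torsionMap W _ a) (hτ.torsionMap W _ b) = -e j a b := fun j a b ↦ hext j _ _ (by
    rw [he, hneg, he]
    change ιK (w j (A j (hτ.torsionMap W _ a)) (A j (hτ.torsionMap W _ b))) = (ιK (w j (A j a) (A j b)))⁻¹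
    rw [hAτ, hAτ, hw_gal j _ _ _ (hA j a) (hA j b),
      RatClosure.smul_eq_inv_of_pow_eq_one hc₀ (pow_ne_zero j hpp.ne_zero) (hw_pow j _ _ (hA j a) (hA j b)),
      map_inv₀])
  -- (W5) left non-degeneracy
  have hW5 : ∀ j a, (∀ b, e j a b = 0) → a = 0 := fun j a ha ↦ by
    have h0 : A j a = 0 := by
      refine hw_nd j (A j a) (hA j a) fun S hS ↦ ?_
      obtain ⟨b, rfl⟩ := hAsurj j S hS
      have h := congrArg (fun v ↦ ((muVal K (p ^ j) v : (AlgebraicClosure K)ˣ) : AlgebraicClosure K))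
        ((hW2 j a b).trans (by rw [ha b, neg_zero]))
      simp only [he, f, muVal_zero, Units.val_one] at h
      exact ιK.injective (h.trans (map_one ιK).symm)
    have h1 : ι j a = 0 := Subtype.ext h0
    simpa using congrArg (ι j).symm h1
  -- (W6) exhaustion of `Hom(E_K[p^j], μ_{p^j})`, by counting
  have hfin : ∀ j, Finite (geomTorsion E ((p : ℤ) ^ j)) := fun j ↦
    finite_torsionPoints_holds E (AlgebraicClosure K) (n := (p : ℤ) ^ j)
      (pow_ne_zero j (by exact_mod_cast hpp.ne_zero))
  have hkill : ∀ j (m : geomTorsion E ((p : ℤ) ^ j)), (p ^ j) • m = 0 := fun j m ↦ by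
    apply Subtype.ext
    rw [AddSubgroupClass.coe_nsmul, ← natCast_zsmul, hcast, ZeroMemClass.coe_zero]
    exact (mem_geomTorsion_iff E _ _).mp m.2
  have hW6 : ∀ j (ψ : geomTorsion E ((p : ℤ) ^ j) →+ MuCarrier K (p ^ j)), ∃ w, ∀ b, e j w b = ψ b := fun j ψ ↦ by
    haveI := hfin j
    have hcard : Nat.card (geomTorsion E ((p : ℤ) ^ j) →+ MuCarrier K (p ^ j)) =
        Nat.card (geomTorsion E ((p : ℤ) ^ j)) :=
      HomCarrier.natCard_eq (M := geomTorsion E ((p : ℤ) ^ j)) (Ω := MuCarrier K (p ^ j))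
        (AddEquiv.ofBijective (log j) (hlog_bij j)) (hkill j)
    haveI : Finite (geomTorsion E ((p : ℤ) ^ j) →+ MuCarrier K (p ^ j)) :=
      Nat.finite_of_card_ne_zero (by rw [hcard]; exact Nat.card_pos.ne')
    have hinj : Function.Injective (e j) := fun a a' h ↦ by
      rw [← sub_eq_zero]
      refine hW5 j _ fun b ↦ ?_
      rw [map_sub, AddMonoidHom.sub_apply, h, sub_self]
    obtain ⟨w, hw⟩ := (hinj.bijective_of_nat_card_le hcard.le).2 ψ
    exact ⟨w, fun b ↦ by rw [← hw]⟩
  -- (W7) level compatibility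
  have hAred : ∀ j (a : geomTorsion E ((p : ℤ) ^ (j + 1))), A j (E.geomTorsionReduce p j a) = (p : ℤ) • A (j + 1) a :=
    fun j a ↦ by
      change (RatClosure.pointsEquiv (K := K) W).symm ((E.geomTorsionReduce p j a : geomTorsion E _) : geomPoints E) =
        (p : ℤ) • (RatClosure.pointsEquiv (K := K) W).symm (a : geomPoints E)
      rw [coe_geomTorsionReduce, map_zsmul]
  have hW7 : ∀ j a b, muVal K (p ^ j) (e j (E.geomTorsionReduce p j a) (E.geomTorsionReduce p j b)) =
      muVal K (p ^ (j + 1)) (e (j + 1) a b) ^ p := fun j a b ↦ by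
    apply Units.ext
    rw [Units.val_pow_eq_pow_val, he, he]
    change ιK (w j (A j (E.geomTorsionReduce p j a)) (A j (E.geomTorsionReduce p j b))) =
      ιK (w (j + 1) (A (j + 1) a) (A (j + 1) b)) ^ p
    rw [hAred, hAred, hw_compat j _ _ (hA (j + 1) a) (hA (j + 1) b), map_pow]
  exact ⟨e, log, hW1, hW2, hW3, hW4, hW5, hW6, hW7, hlog_bij, hlog_cyc, hlog_compat⟩

/-! ## §3 Howard's form `ẽ_j(a, b) = log_j e_j(a, τ_* b)`: the inputs of `eisensteinDualityDatum`, compatibly -/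

omit [NumberField K] hp in
/-- `τ_*` commutes with `p· : E_K[p^{j+1}] → E_K[p^j]` (both are additive maps on points). [folklore] -/
private theorem torsionMap_geomTorsionReduce {k : Type*} [Field k] [Algebra k K] (V : WeierstrassCurve k)
    {σ : K ≃ₐ[k] K} {τ : AlgebraicClosure K ≃+* AlgebraicClosure K} (hτ : IsLiftOfAut σ τ) (j : ℕ)
    (a : geomTorsion (V.baseChange K) ((p : ℤ) ^ (j + 1))) :
    hτ.torsionMap V _ ((V.baseChange K).geomTorsionReduce p j a) =
      (V.baseChange K).geomTorsionReduce p j (hτ.torsionMap V _ a) := by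
  apply Subtype.ext
  simp only [IsLiftOfAut.coe_torsionMap, coe_geomTorsionReduce, map_zsmul]

/-- **The `E`-level H.4 forms from the Weil pairing, at every level and LEVEL-COMPATIBLY.**  For `E = W/ℚ` elliptic,
`K` a number field, `p` prime and `τ` a lift of `σ ∈ Aut(K/ℚ)` which is the transport of a complex conjugation
`c₀ ∈ Γ_ℚ`, there are bi-additive `e_j : E_K[p^j] × E_K[p^j] → μ_{p^j}(K̄)` and additive bijections
`log_j : μ_{p^j}(K̄) ≅ ℤ/p^j` such that, with `θ_j = τ_*` (`IsLiftOfAut.torsionMap`) and Howard's form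
`ẽ_j := conjPairing (e j) θ_j (log j)` (`(a, b) ↦ log_j e_j(a, τ_* b)`, Rem. 1.3.2):
(i) `e_j(a, a) = 0`, `e_j(ga, gb) = g · e_j(a, b)`, `e_j(τ_* a, τ_* b) = −e_j(a, b)`, `τ_* τ_* = id`, `log_j` bijective;
(ii) the four hypotheses of `ZpExtension.eisensteinDualityDatum` for `ẽ_j` on
`(W.baseChange K).torsionGaloisModule ((p : ℤ) ^ j)`: symmetric, `ẽ_j(g a, (τ⁻¹gτ) b) = χ̄_j(g) ẽ_j(a, b)`
(`IsLiftOfAut.conjGalCMH`, `cyclotomicCharacterModPow`), left-non-degenerate, exhausting `Hom(E_K[p^j], ℤ/p^j)`;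
(iii) **level compatibility** `ẽ_j(p·a, p·b) = (ẽ_{j+1}(a, b) mod p^j)` along `geomTorsionReduce` (the `E`-level
input of `DVRSetting.SatisfiesH.e_red`); (iv) the sign identity `ẽ_j(τ_* a, τ_* b) = −ẽ_j(a, b)` (H.5(c)).
[cite: Howard2004HeegnerKolyvagin, §1.3 H.4 and Rem. 1.3.2 (arXiv p. 7, L69–90)] [cite: SilvermanAEC2009, Prop. III.8.1 (a)–(e)] -/
theorem exists_conjPairing_tower {σ : K ≃ₐ[ℚ] K} {τ : AlgebraicClosure K ≃+* AlgebraicClosure K}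
    (hτ : IsLiftOfAut σ τ) {c₀ : absoluteGaloisGroup ℚ} (hc₀ : IsComplexConjugation (Rat.castHom ℝ) c₀)
    (hγ : ∀ x, τ x = absGaloisTransport (K := ℚ) (L := K) c₀ x) :
    ∃ (e : ∀ j : ℕ, geomTorsion (W.baseChange K) ((p : ℤ) ^ j) →+ geomTorsion (W.baseChange K) ((p : ℤ) ^ j) →+
        MuCarrier K (p ^ j))
      (log : ∀ j : ℕ, MuCarrier K (p ^ j) →+ ZMod (p ^ j)),
      -- (i) raw facts
      (∀ j a, e j a a = 0) ∧
      (∀ j (g : absoluteGaloisGroup K) a b, e j (g • a) (g • b) = mu K (p ^ j) g (e j a b)) ∧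
      (∀ j a b, e j (hτ.torsionMap W _ a) (hτ.torsionMap W _ b) = -e j a b) ∧
      (∀ j (a : geomTorsion (W.baseChange K) ((p : ℤ) ^ j)), hτ.torsionMap W _ (hτ.torsionMap W _ a) = a) ∧
      (∀ j, Function.Bijective (log j)) ∧
      -- (ii) the four `eisensteinDualityDatum` hypotheses for `ẽ_j = conjPairing (e j) τ_* (log j)`
      (∀ j a b, conjPairing (e j) (hτ.torsionMap W _) (log j) a b = conjPairing (e j) (hτ.torsionMap W _) (log j) b a) ∧
      (∀ j (g : absoluteGaloisGroup K) a b,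
        conjPairing (e j) (hτ.torsionMap W _) (log j) ((W.baseChange K).torsionGaloisModule ((p : ℤ) ^ j) g a)
            ((W.baseChange K).torsionGaloisModule ((p : ℤ) ^ j) (hτ.conjGalCMH g) b) =
          cyclotomicCharacterModPow K p j g * conjPairing (e j) (hτ.torsionMap W _) (log j) a b) ∧
      (∀ j w, (∀ b, conjPairing (e j) (hτ.torsionMap W _) (log j) w b = 0) → w = 0) ∧
      (∀ j (φ : geomTorsion (W.baseChange K) ((p : ℤ) ^ j) →+ ZMod (p ^ j)),
        ∃ w, ∀ b, conjPairing (e j) (hτ.torsionMap W _) (log j) w b = φ b) ∧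
      -- (iii) level compatibility
      (∀ j a b, conjPairing (e j) (hτ.torsionMap W _) (log j) ((W.baseChange K).geomTorsionReduce p j a)
            ((W.baseChange K).geomTorsionReduce p j b) =
          ZMod.castHom (pow_dvd_pow p j.le_succ) (ZMod (p ^ j))
            (conjPairing (e (j + 1)) (hτ.torsionMap W _) (log (j + 1)) a b)) ∧
      -- (iv) the sign identity
      (∀ j a b, conjPairing (e j) (hτ.torsionMap W _) (log j) (hτ.torsionMap W _ a) (hτ.torsionMap W _ b) =
        -conjPairing (e j) (hτ.torsionMap W _) (log j) a b) := by
  obtain ⟨e, log, hW1, hW2, hW3, hW4, hW5, hW6, hW7, hL1, hL2, hL3⟩ :=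
    W.exists_weilPairingHom_tower_baseChange p hτ hc₀ hγ
  -- `τ` is an involution, hence so is `τ_*`
  have hinv : ∀ x, τ (τ x) = x := fun x ↦ by
    rw [hγ, hγ]
    exact RatClosure.absGaloisTransport_absGaloisTransport_of_sq_eq_one hc₀.sq_eq_one x
  have hθθ : ∀ j (a : geomTorsion (W.baseChange K) ((p : ℤ) ^ j)),
      hτ.torsionMap W _ (hτ.torsionMap W _ a) = a := fun j a ↦ hτ.torsionMap_torsionMap W hinv _ a
  refine ⟨e, log, hW1, hW3, hW4, hθθ, hL1, fun j a b ↦ ?_, fun j g a b ↦ ?_, fun j w hw ↦ ?_, fun j φ ↦ ?_,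
    fun j a b ↦ ?_, fun j a b ↦ ?_⟩
  · exact conjPairing_symm (e j) _ (log j) (hW2 j) (hθθ j) (hW4 j) a b
  · refine conjPairing_equivariant ((W.baseChange K).torsionGaloisModule ((p : ℤ) ^ j)) (e j) _ (log j)
      hτ.conjGalCMH (cyclotomicCharacterModPow K p j) (fun g a b ↦ ?_) (fun g a ↦ ?_) (hL2 j) g a b
    · simp only [torsionGaloisModule_apply_apply, hW3]
    · simp only [torsionGaloisModule_apply_apply, hτ.torsionMap_smul]
  · exact conjPairing_left_nondegenerate (e j) _ (log j) (hW5 j) (hθθ j) (hL1 j).1 w hw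
  · exact conjPairing_left_exhausting (e j) _ (log j) (hW6 j) (hθθ j) (hL1 j) φ
  · rw [conjPairing_apply, conjPairing_apply, torsionMap_geomTorsionReduce]
    exact hL3 j _ _ (hW7 j a _)
  · rw [conjPairing_apply, conjPairing_apply, hθθ, ← map_neg, ← hW4 j a, hθθ]

end WeierstrassCurve

end
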